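import Summits.QuantumFields.YangMills.Theorems.BalabanUVNodesN06G0CoreFromThm310AtPinsGUSPC

/-!
# N06 [B9] — THE FORM SMALLNESS AND THE SECT.-D IDENTITIES FROM THE L² STEP (the second half of the split of `…N06G0LayerFromThm310AtPinsGUSP`,
# programme P-D2, cut B″ of dag-n06-d's LOCATED-D2-CYCLE)

T. Bałaban, *Propagators for lattice gauge theories in a background field*, Commun. Math. Phys. **99** (1985) 389–434 [`Balaban1985BackgroundPropagators`, "B9"],
Thm 3.11 p. 416 + (3.120)–(3.128) pp. 419–421 (the resolvent identities behind (3.130)∕(3.138)), (3.46) p. 398; [4] = T. Bałaban, *Propagators and renormalization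
transformations for lattice gauge theories. II*, Commun. Math. Phys. **96** (1984) 223–250 [`Balaban1984PropagatorsII`], Lemma 2.1 (2.61) p. 234.

WHY (cell `pub-ymgap`, node N06, bundle F7 rows 20–21, seat dag-n06-l g33).  GUSP's lines l.307–319 — the relative form bound `FormSmall (𝔬12 x) (r12·Mα₀) U` from the
block-L² step (`formSmall_of_stepL2`, this lineage's `B9Thm312WholeFormSmallFromL2`) and the Sect.-D identities given it (`hIdOfForm`) — as a theorem of their own, so that
the certificate can run them AFTER it has derived the (3.137) letter that the L² step consumes (the Δ⁽²⁾-free G₀ core being `…GUSPC.g0_core_of_thm310_coreDir₃USP`).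
★ `formSmall_identities_of_stepL2`: inputs `hstepL2` (the certificate's `StepL2` at `θ2₁₂·Mα₀`, rate `δK12`), `hpos12` (Δ_a > 0 in coordinates), `hinv12`
(`G₀Δ_a = 1`), `hsym12` (`G₀` symmetric), `hl0` (the `l0` field of `Thm33G0L2M` = `(g0_core …).hG0C.2.2.l0`, constant `B12₂`, rate `δ12₀`), `hIdOfForm`, numerics
`θ2₁₂ σS` with `σS ≤ δ12₀`, `σS ≤ δK12`; outputs `∃ r12 MF aF`, `0 ≤ r12`, `0 < aF ≤ a12`, `M12 ≤ MF` and, above `MF` with `Mα₀ ≤ aF`, `FormSmall (𝔬12 x) (r12·Mα₀) U ∧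
Identities (𝔬12 x) U` — the old `(hmodel12 …).2` of GUSP verbatim (`aF := min a12 (2r12 + 2)⁻¹`, the factor GUSP had inside its `a₀`).
HONEST LABEL: helper (re-cut of a landed face), count-neutral; every analytic member a displayed HYPOTHESIS; N06 NOT discharged; nothing continuum ∕ OS ∕ mass gap ∕ Clay.
-/

noncomputable section

namespace Summit.QuantumFields.YangMills.BalabanUVNodes.N06FormSmallIdentitiesAtPinsUSP

open Literature.MathematicalPhysics.QuantumFieldTheory.Balaban1983to89
open Literature.MathematicalPhysics.QuantumFieldTheory.Balaban1983to89.B9Thm34Ext (toB6)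
open Literature.MathematicalPhysics.QuantumFieldTheory.Balaban1983to89.B11SectG (BlockNorm HasMaj RowSum)
open Literature.MathematicalPhysics.QuantumFieldTheory.Balaban1983to89.B9Thm37Glue (IsTransposePair)
open Literature.MathematicalPhysics.QuantumFieldTheory.Balaban1983to89.B9Thm312Whole (Ops FormSmall PosDefEnd GeoOK)
open Literature.MathematicalPhysics.QuantumFieldTheory.Balaban1983to89.B9Thm312WholeL2 (StepL2)
open Literature.MathematicalPhysics.QuantumFieldTheory.Balaban1983to89.B9SectDL2Decay (BlockBd)
open Literature.MathematicalPhysics.QuantumFieldTheory.Balaban1983to89.B9PinMembersKLevelV1 (MemberY geo9Y)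
open Literature.MathematicalPhysics.QuantumFieldTheory.Balaban1983to89.B9GeoLemma21KLevelV1 (geo9Y_len_pos geo9Y_dist_triangle geo9Y_dist_comm rowSum261_geo9Y)
open Literature.MathematicalPhysics.QuantumFieldTheory.Balaban1983to89.B9GeoNormsKLevelV1 (geo9K_dist_nonneg)
open Literature.MathematicalPhysics.QuantumFieldTheory.Balaban1983to89.B9Thm312WholeFormSmallFromL2 (formSmall_of_stepL2)

variable {d ℓ : ℕ} {hd : 1 ≤ d + 1} {hL : Odd (ℓ + 1) ∧ 1 < ℓ + 1} {b₀ b₁ : ℝ} {Mstar : ℕ}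
variable [∀ x : MemberY d ℓ hd hL b₀ b₁ Mstar, Fintype (geo9Y x).Site]
variable {c35 : ℝ} {bg : MemberY d ℓ hd hL b₀ b₁ Mstar → B9.Backgrounds}

/-- ★ **FORM SMALLNESS AND THE SECT.-D IDENTITIES FROM THE L² STEP** (module docstring): GUSP's `(hmodel12 …).2` on its own — `FormSmall (𝔬12 x) (r12·Mα₀) U`
by `formSmall_of_stepL2` (row sum at `σS`, `G₀`'s symmetry ∕ positivity ∕ inverse ∕ L² block, the step `StepL2`), then the identities by `hIdOfForm` at the ratio
`r12·Mα₀ < 1` (regime `aF := min a12 (2r12 + 2)⁻¹`). [cite: Balaban1985BackgroundPropagators, Thm 3.11 p.416 + (3.120)–(3.128) pp.419–421 + (3.46) p.398; Balaban1984PropagatorsII, Lemma 2.1 (2.61) p.234] -/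
theorem formSmall_identities_of_stepL2 {X Y Z W : MemberY d ℓ hd hL b₀ b₁ Mstar → Type}
    [∀ x, Fintype (X x)] [∀ x, DecidableEq (X x)] [∀ x, Fintype (Y x)] [∀ x, Fintype (Z x)] [∀ x, Fintype (W x)]
    (H : MemberY d ℓ hd hL b₀ b₁ Mstar → Prop)
    (𝔬12 : ∀ x : MemberY d ℓ hd hL b₀ b₁ Mstar, Ops (geo9Y x) (bg x) (X x) (Y x) (Z x) (W x))
    (θ2₁₂ δ12₀ δK12 B12₂ a12 M12 σS : ℝ) (ha12 : 0 < a12) (hM12 : 0 < M12) (hθ2₁₂ : 0 ≤ θ2₁₂) (hB12₂ : 0 ≤ B12₂)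
    (hσS : 0 < σS) (hσ0 : σS ≤ δ12₀) (hσSK : σS ≤ δK12)
    (hsym12 : ∀ x : MemberY d ℓ hd hL b₀ b₁ Mstar, M12 ≤ (geo9Y x).M → ∀ α₀ : ℝ, 0 < α₀ → (geo9Y x).M * α₀ ≤ a12 →
      ∀ U : (bg x).Cfg, (bg x).Reg335 c35 α₀ U → (bg x).Reg336 c35 α₀ U → IsTransposePair ((𝔬12 x).G0 U) ((𝔬12 x).G0 U))
    (hpos12 : ∀ x : MemberY d ℓ hd hL b₀ b₁ Mstar, M12 ≤ (geo9Y x).M → ∀ α₀ : ℝ, 0 < α₀ → (geo9Y x).M * α₀ ≤ a12 →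
      ∀ U : (bg x).Cfg, (bg x).Reg335 c35 α₀ U → (bg x).Reg336 c35 α₀ U → PosDefEnd ((𝔬12 x).S0 U))
    (hinv12 : ∀ x : MemberY d ℓ hd hL b₀ b₁ Mstar, M12 ≤ (geo9Y x).M → ∀ α₀ : ℝ, 0 < α₀ → (geo9Y x).M * α₀ ≤ a12 →
      ∀ U : (bg x).Cfg, (bg x).Reg335 c35 α₀ U → (bg x).Reg336 c35 α₀ U → (𝔬12 x).G0 U * (𝔬12 x).S0 U = 1)
    (hl0 : ∀ x : MemberY d ℓ hd hL b₀ b₁ Mstar, M12 ≤ (geo9Y x).M → ∀ α₀ : ℝ, 0 < α₀ → (geo9Y x).M * α₀ ≤ a12 →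
      ∀ U : (bg x).Cfg, (bg x).Reg335 c35 α₀ U → (bg x).Reg336 c35 α₀ U →
        BlockBd (g := toB6 (geo9Y x) 1 (H x)) (𝔬12 x).blk (𝔬12 x).blk ((𝔬12 x).G0 U)
          (fun (y y' : (geo9Y x).Site) => B12₂ * (geo9Y x).len y * (geo9Y x).len y' * Real.exp (-(δ12₀ * (geo9Y x).dist y y'))))
    (hIdOfForm : ∀ x : MemberY d ℓ hd hL b₀ b₁ Mstar, M12 ≤ (geo9Y x).M → ∀ α₀ : ℝ, 0 < α₀ → (geo9Y x).M * α₀ ≤ a12 →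
      ∀ U : (bg x).Cfg, (bg x).Reg335 c35 α₀ U → (bg x).Reg336 c35 α₀ U →
        ∀ r : ℝ, r < 1 → FormSmall (𝔬12 x) r U → B9Thm312Whole.Identities (𝔬12 x) U)
    (hstepL2 : ∀ x : MemberY d ℓ hd hL b₀ b₁ Mstar, M12 ≤ (geo9Y x).M → ∀ α₀ : ℝ, 0 < α₀ → (geo9Y x).M * α₀ ≤ a12 →
      ∀ U : (bg x).Cfg, (bg x).Reg335 c35 α₀ U → (bg x).Reg336 c35 α₀ U →
        StepL2 (𝔬12 x) 1 (H x) (θ2₁₂ * ((geo9Y x).M * α₀)) δK12 U) :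
    ∃ r12 MF aF : ℝ, 0 ≤ r12 ∧ 0 < aF ∧ aF ≤ a12 ∧ M12 ≤ MF ∧
      ∀ x : MemberY d ℓ hd hL b₀ b₁ Mstar, MF ≤ (geo9Y x).M → ∀ α₀ : ℝ, 0 < α₀ → (geo9Y x).M * α₀ ≤ aF →
        ∀ U : (bg x).Cfg, (bg x).Reg335 c35 α₀ U → (bg x).Reg336 c35 α₀ U →
          FormSmall (𝔬12 x) (r12 * ((geo9Y x).M * α₀)) U ∧ B9Thm312Whole.Identities (𝔬12 x) U := by
  -- [4] (2.61) for the record geometry at the step's row-sum rate σS, constant `max cσ 0`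
  obtain ⟨MLσ, cσ, hrow0⟩ := rowSum261_geo9Y (d := d) (ℓ := ℓ) (hd := hd) (hL := hL) (b₀ := b₀) (b₁ := b₁) (Mstar := Mstar) σS hσS
  set c' : ℝ := max cσ 0 with hc'
  have hc'0 : 0 ≤ c' := le_max_right _ _
  have hrow : ∀ x : MemberY d ℓ hd hL b₀ b₁ Mstar, MLσ ≤ (geo9Y x).M → RowSum (toB6 (geo9Y x) 1 (H x)) σS c' :=
    fun x hM y => (hrow0 x hM y).trans (le_max_left _ _)
  set r12 : ℝ := θ2₁₂ * c' * (B12₂ * c') with hr12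
  have hr12nn : 0 ≤ r12 := mul_nonneg (mul_nonneg hθ2₁₂ hc'0) (mul_nonneg hB12₂ hc'0)
  refine ⟨r12, max M12 MLσ, min a12 (1 / (2 * r12 + 2)), hr12nn, lt_min ha12 (by positivity), min_le_left _ _, le_max_left _ _,
    fun x hM α₀ hα ha U hU hU' => ?_⟩
  have hM12x : M12 ≤ (geo9Y x).M := (le_max_left _ _).trans hM
  have hMLσx : MLσ ≤ (geo9Y x).M := (le_max_right _ _).trans hM
  have ha12x : (geo9Y x).M * α₀ ≤ a12 := ha.trans (min_le_left _ _)
  have hMα : 0 ≤ (geo9Y x).M * α₀ := mul_nonneg (hM12.le.trans hM12x) hα.le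
  have hgeo : GeoOK (geo9Y x) := ⟨geo9Y_dist_triangle x, geo9Y_dist_comm x, geo9K_dist_nonneg x.toKIdx, geo9Y_len_pos x⟩
  have hform : FormSmall (𝔬12 x) (r12 * ((geo9Y x).M * α₀)) U :=
    formSmall_of_stepL2 (R₀ := 1) (H₀ := H x) hgeo (hrow x hMLσx) hc'0 hσ0 hσSK hB12₂ (mul_nonneg hθ2₁₂ hMα)
      (le_of_eq (by rw [hr12]; ring)) (hsym12 x hM12x α₀ hα ha12x U hU hU') (hpos12 x hM12x α₀ hα ha12x U hU hU') (hinv12 x hM12x α₀ hα ha12x U hU hU')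
      (hl0 x hM12x α₀ hα ha12x U hU hU') (hstepL2 x hM12x α₀ hα ha12x U hU hU')
  have hr1 : r12 * ((geo9Y x).M * α₀) < 1 := by
    have ha3 : (geo9Y x).M * α₀ ≤ 1 / (2 * r12 + 2) := ha.trans (min_le_right _ _)
    have h2 : 0 < 2 * r12 + 2 := by positivity
    calc r12 * ((geo9Y x).M * α₀) ≤ r12 * (1 / (2 * r12 + 2)) := mul_le_mul_of_nonneg_left ha3 hr12nn
      _ < 1 := by rw [mul_one_div, div_lt_one h2]; linarith
  exact ⟨hform, hIdOfForm x hM12x α₀ hα ha12x U hU hU' _ hr1 hform⟩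

end Summit.QuantumFields.YangMills.BalabanUVNodes.N06FormSmallIdentitiesAtPinsUSP

end
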